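import Literature.MathematicalPhysics.QuantumFieldTheory.Balaban1983to89.B9Thm314GpFlatMultiLevelTorus
import Literature.MathematicalPhysics.QuantumFieldTheory.Balaban1983to89.B6Prop22AdjMultiLevelTorus
import Literature.MathematicalPhysics.QuantumFieldTheory.Balaban1983to89.B6Prop22LapMultiLevelTorus

/-!
# `Balaban1983to89.B9Ineq346GpFlatMultiLevelTorus` — [B9] (3.46) AT `U = 1`: THE FOUR `L²` MEMBERS OF THEOREM 3.1 FOR
THE SCALAR PROPAGATOR `G′ = Δ′_a⁻¹` ON THE GENUINE `k`-LEVEL TORUS, FROM THE SUP MEMBERS [4] (2.67) BY SCHUR'S TEST —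
for `supp λ ⊂ B(y′)`: `Σ_{x∈B(y)}((G′λ)(x))² ≤ C·L^{2j(y)}L^{2j(y′)}·e^{−δd(y,y′)}·Σλ²`,
`Σ_{x∈B(y)}((∇_μG′λ)(x))², Σ_{x∈B(y)}((G′∇_μ*λ)(x))² ≤ C·L^{j(y)}L^{j(y′)}·e^{−δd(y,y′)}·Σλ²`,
`Σ_{x∈B(y)}((ΔG′λ)(x))² ≤ C·e^{−δd(y,y′)}·Σλ²` (r06's residual G-B9-03a: «(3.46) at U = 1 is not printed in [4]»; no
existing module is touched; no fact is minted)

FRAMING (verbatim cell line):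
statement-level skeleton of published theorems with citation tags; proofs where landed; nothing here is a claim about the Yang–Mills mass gap

Sources under audit (cell pub-balaban / lit-balaban): T. Bałaban, *Propagators for lattice gauge theories in a
background field*, Commun. Math. Phys. **99** (1985) 389–434 [`Balaban1985BackgroundPropagators`, "B9"], p. 398 [PDF 10]
((3.46) and the remarks «we may always replace ∇_U by ∇*_U», «the choice of powers Lʲη is conventional also»);
T. Bałaban, *Propagators and renormalization transformations for lattice gauge theories. II*, Commun. Math. Phys. **96**
(1984) 223–250 [`Balaban1984PropagatorsII`, "[4]"], Prop. 2.2 (2.67) p. 234 (entries 1, 2, 3, 6), (2.13)–(2.14) p. 225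
(symmetry of `Δ′_a`; `−Δ = Δ′_a − Q′*aQ′`), (2.60) p. 234.  Unit `lit-balaban-p21` (Phase-2 proof seat p21 gen 18, HOME
`run/shared/lean/pub/lit-balaban/`; B9 fold owner r06 — B9-CLOSURE §5 item 1 «residual G-B9-03a: (3.44)–(3.46) at U = 1
are not printed in [4]»; B6 fold owner r03; referee ref-4).  Inputs BY NAME: the torus (2.67) entries
`prop22_first/second/third/sixth_multiLevelTorus`, `gmlT_transpose`, `perLapT_isSymm`, `perLapT_eq_mlOpT_sub`,
`gmlT_mul_mlOpT_pos`, the box lineage's `vOp_apply`/`vOp_mulVec_abs_le`, `levelSepTB` + `B6Ineq268.ratio_mul_exp_le`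
((2.60)), `B9Thm314GpFlatMultiLevelTorus.consts_260_261`/`weights_repair`/`gmlT_congr`.

## WHAT IS PRINTED (B9 p. 398, verbatim up to notation; the scan of (3.46) is partly illegible)

«Finally, we have the inequalities in L²-norms ‖hG′(U)λ‖, ‖h∇_UG′(U)λ‖, …, ‖hΔ_UG′(U)λ‖ ≤ B₀{(Lʲη)², Lʲη, …, 1}
e^{−δ₀d(y,y′)}‖λ‖ for supp h ⊂ Δ̃(y), y ∈ Λ_j, supp λ ⊂ Δ(y′); (3.46)» … «the choice of derivatives ∇_U, ∇*_U is
conventional, we may always replace ∇_U by ∇*_U» … «the choice of powers Lʲη is conventional also. Using Lemma 2.1 in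
[4] we may replace the factor (Lʲη)^α by (Lʲη)^β(L^{j′}η)^γ with β + γ = α».  [4] prints only the sup/Hölder members
(2.67) at `U = 1`; the `L²` members at `U = 1` are derived here.

## THE ROUTE (Schur's test; kernel-checked)

For a kernel `T` with block majorant `K` (rows) and a block majorant `K′` of `Tᵀ` (columns), the block-cut kernel
`1_{B(y)}T1_{B(y′)}` has absolute row sums `≤ K(y,y′)` and column sums `≤ K′(y′,y)`, so by Cauchy–Schwarz
`Σ_{x∈B(y)}((Tλ)(x))² ≤ K(y,y′)K′(y′,y)·Σλ²` for `supp λ ⊂ B(y′)` (§1–§2).  For `G′`: `G′ᵀ = G′`, both from (2.67)₁.  For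
`∇_μG′`: `(∇_μG′)ᵀ = G′∇_μ*`, (2.67)₂ and (2.67)₃; symmetrically for `G′∇_μ*`.  For `ΔG′` (periodic Laplacian): rows
from (2.67)₆; columns from `(ΔG′)ᵀ = G′Δ = G′(Δ′_a − Q′*aQ′) = 1 − G′Q′*aQ′`, where `Q′*aQ′` maps a vector supported
in `B(y)` to one supported in `B(y)` of size `a₊L^{−2j(y)}` and (2.67)₁ gives `C₀L^{2j(x)}e^{−δd}` — the mismatch
`L^{2j(x)}/L^{2j(y)}` is paid by (2.60) (`e^{−¼δd} ≤ L²·…` once `R·L·M_h` is large), leaving `(1 + C₀a₊L²)e^{−¾δd}` (§4).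

## WHAT THIS FILE CERTIFIES (lattice units; the torus lineage `TDomains`)

* §1 **`schur_sq`**; §2 `row_abs_sum_le_of_bound`, `row_abs_sum_le`, `col_abs_sum_le`, **`l2_block_sq_le_of_sums`**
  (explicit row/column sums for ONE pair of blocks — the form reusable for operators bounded only on some blocks, e.g.
  the Theorem 3.14 differences), **`l2_block_sq_le`** (from two block majorants), `l2_union_sq_le` (v1.1: the same
  for `h` = the indicator of a finite UNION of blocks — print's `supp h ⊂ Δ̃(y)`).
* §3 **`ineq346_Gp_flat_multiLevelTorus`**, **`ineq346_dGp_flat_multiLevelTorus`**, **`ineq346_Gpd_flat_multiLevelTorus`**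
  — `k`-uniform `δ, C, M₀, N₀` (thresholds of the torus Prop. 2.2) with the three displayed bounds for every torus
  family `D`, blocks `y, y′` of `𝔅[D]` and `λ = 0` off `B(y′)`.
* §4 `vOp_mulVec_blockSupp`, `transfer_pair`, **`hasMajorant_transpose_lapGp`** (the block majorant
  `(1 + C₀a₊L²)e^{−¾δd}` of `(ΔG′)ᵀ`), **`ineq346_lapGp_flat_multiLevelTorus`** (the `ΔG′` member, threshold also
  `R·L·M_h ≥ N₁ + 1` of (2.60)).

## HONEST SCOPE

* `U = 1` only; the four `L²` members for `G′`, `∇_μG′`, `G′∇_μ*`, `ΔG′` (not the mixed (3.44)–(3.45)); `h` is replaced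
  by the indicator of ONE block `B(y)` of `𝔅` and `supp λ ⊂ Δ(y′)` by `λ = 0` off the block `B(y′)` (print's `Δ̃(y)`,
  `Δ(y′)` are bounded unions of blocks; the block version is the atomic case); the inequalities are stated SQUARED; the
  weights come out symmetric in `j(y), j(y′)` (`L^{2(j+j′)}`, `L^{j+j′}`, `1`), which is print's form up to its remark
  that the distribution of the powers between `j` and `j′` is conventional; `Δ` = the periodic Laplacian `perLapT` of
  the torus lineage (sign immaterial for squares); lattice units (the `η^d` of the `L²` norms cancel between the two
  sides).  Nothing is inferred from the manuscript: every step is kernel-checked.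
-/

namespace Literature.MathematicalPhysics.QuantumFieldTheory.Balaban1983to89.B9Ineq346GpFlatMultiLevelTorus

open Finset Matrix
open Literature.MathematicalPhysics.QuantumFieldTheory.Balaban1983to89.B4Reflection242 (boxDom mem_boxDom blk avgK)
open Literature.MathematicalPhysics.QuantumFieldTheory.Balaban1983to89.B6MultiLevelBoxOperator
open Literature.MathematicalPhysics.QuantumFieldTheory.Balaban1983to89.B6MultiLevelTorusOperator
open Literature.MathematicalPhysics.QuantumFieldTheory.Balaban1983to89.B6Geom246MultiLevelBox
open Literature.MathematicalPhysics.QuantumFieldTheory.Balaban1983to89.B6Geom246MultiLevelTorus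
open Literature.MathematicalPhysics.QuantumFieldTheory.Balaban1983to89.B8Ineq192MultiLevelTorus (geomTB geomTB_dist
  geomTB_L geomTB_RM levelSepTB symmT)
open Literature.MathematicalPhysics.QuantumFieldTheory.Balaban1983to89.B6Prop22MultiLevelTorus (prop22_first_multiLevelTorus
  gmlT_mul_mlOpT_pos)
open Literature.MathematicalPhysics.QuantumFieldTheory.Balaban1983to89.B6Prop22DerivMultiLevelTorus (dT
  prop22_second_multiLevelTorus)
open Literature.MathematicalPhysics.QuantumFieldTheory.Balaban1983to89.B6Prop22AdjMultiLevelTorus (gmlT_transpose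
  prop22_third_multiLevelTorus)
open Literature.MathematicalPhysics.QuantumFieldTheory.Balaban1983to89.B6Prop22LapMultiLevelBox (vOp vOp_apply vOp_mulVec_abs_le)
open Literature.MathematicalPhysics.QuantumFieldTheory.Balaban1983to89.B6Prop22LapMultiLevelTorus (perLapT_eq_mlOpT_sub
  prop22_sixth_multiLevelTorus)
open Literature.MathematicalPhysics.QuantumFieldTheory.Balaban1983to89.B6RandomWalk (HasMajorant BlockSupp)
open Literature.MathematicalPhysics.QuantumFieldTheory.Balaban1983to89.B6Ineq243TwoLevelBox (aNext)
open Literature.MathematicalPhysics.QuantumFieldTheory.Balaban1983to89.B6Ineq268 (mx LevelSep ratio ratio_mul_exp_le)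
open Literature.MathematicalPhysics.QuantumFieldTheory.Balaban1983to89.B9Thm314GpFlatMultiLevelTorus (consts_260_261
  weights_repair gmlT_congr)

noncomputable section

variable {d : ℕ}

/-! ## §1 Schur's test -/

section Schur

/-- **SCHUR'S TEST** (squared form): `Σ_i(Σ_j K_{ij}v_j)² ≤ R·C·Σ_j v_j²` when `Σ_j|K_{ij}| ≤ R` for all `i` and
`Σ_i|K_{ij}| ≤ C` for all `j`. [folklore] [cite: Balaban1985BackgroundPropagators, (3.46) p.398, dictionary (the L² step)] -/
theorem schur_sq {ι κ : Type*} [Fintype ι] [Fintype κ] (K : ι → κ → ℝ) (v : κ → ℝ) {Rr Cc : ℝ} (hR0 : 0 ≤ Rr)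
    (hrow : ∀ i, ∑ j, |K i j| ≤ Rr) (hcol : ∀ j, ∑ i, |K i j| ≤ Cc) :
    ∑ i, (∑ j, K i j * v j) ^ 2 ≤ Rr * Cc * ∑ j, v j ^ 2 := by
  -- one row: Cauchy–Schwarz with the weights `|K_{ij}|`
  have hrow2 : ∀ i, (∑ j, K i j * v j) ^ 2 ≤ Rr * ∑ j, |K i j| * v j ^ 2 := by
    intro i
    have h1 : (∑ j, K i j * v j) ^ 2 ≤ (∑ j, |K i j| * |v j|) ^ 2 := by
      rw [← sq_abs]
      refine pow_le_pow_left₀ (abs_nonneg _) ?_ 2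
      refine (Finset.abs_sum_le_sum_abs _ _).trans (le_of_eq ?_)
      exact Finset.sum_congr rfl fun j _ => abs_mul _ _
    have h2 : (∑ j, |K i j| * |v j|) ^ 2 ≤ (∑ j, |K i j|) * ∑ j, |K i j| * v j ^ 2 := by
      have hcs := Finset.sum_mul_sq_le_sq_mul_sq Finset.univ (fun j => Real.sqrt |K i j|)
        (fun j => Real.sqrt |K i j| * |v j|)
      have e1 : ∀ j, Real.sqrt |K i j| * (Real.sqrt |K i j| * |v j|) = |K i j| * |v j| := fun j => by
        rw [← mul_assoc, Real.mul_self_sqrt (abs_nonneg _)]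
      have e2 : ∀ j, Real.sqrt |K i j| ^ 2 = |K i j| := fun j => Real.sq_sqrt (abs_nonneg _)
      have e3 : ∀ j, (Real.sqrt |K i j| * |v j|) ^ 2 = |K i j| * v j ^ 2 := fun j => by
        rw [mul_pow, Real.sq_sqrt (abs_nonneg _), sq_abs]
      simp only [e1, e2, e3] at hcs
      exact hcs
    have h3 : (∑ j, |K i j|) * ∑ j, |K i j| * v j ^ 2 ≤ Rr * ∑ j, |K i j| * v j ^ 2 :=
      mul_le_mul_of_nonneg_right (hrow i) (Finset.sum_nonneg fun j _ => by positivity)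
    exact h1.trans (h2.trans h3)
  calc ∑ i, (∑ j, K i j * v j) ^ 2 ≤ ∑ i, Rr * ∑ j, |K i j| * v j ^ 2 := Finset.sum_le_sum fun i _ => hrow2 i
    _ = Rr * ∑ j, (∑ i, |K i j|) * v j ^ 2 := by
        rw [← Finset.mul_sum, Finset.sum_comm]
        congr 1
        exact Finset.sum_congr rfl fun j _ => by rw [Finset.sum_mul]
    _ ≤ Rr * ∑ j, Cc * v j ^ 2 := by
        refine mul_le_mul_of_nonneg_left (Finset.sum_le_sum fun j _ => ?_) hR0
        exact mul_le_mul_of_nonneg_right (hcol j) (sq_nonneg _)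
    _ = Rr * Cc * ∑ j, v j ^ 2 := by rw [← Finset.mul_sum]; ring

end Schur

/-! ## §2 Row and column sums over a block from block majorants -/

section Blocks

variable {ℓ Mh k R : ℕ} {P : Fin (d + 1) → ℕ} (D : TDomains d ℓ Mh k P R)

/-- **ROW SUMS FROM A BLOCK BOUND AT ONE SITE**: if `|(Tμ)(x)| ≤ K·B` for every `μ` supported in `B(y′)` with
`|μ| ≤ B`, then `Σ_{z∈B(y′)}|T(x,z)| ≤ K` (test on the sign pattern of the row).
[cite: Balaban1984PropagatorsII, (2.51) p.232, (2.67) p.234, dictionary] -/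
theorem row_abs_sum_le_of_bound {T : Matrix ↥(boxDom (N0 ℓ Mh k P)) ↥(boxDom (N0 ℓ Mh k P)) ℝ}
    (x : ↥(boxDom (N0 ℓ Mh k P))) (y' : ↥(bset D.toDomains)) {K : ℝ}
    (hT : ∀ (μ : ↥(boxDom (N0 ℓ Mh k P)) → ℝ) (B : ℝ), BlockSupp (g := geomT D) (blkOf D.toDomains) μ y' B →
      |(T *ᵥ μ) x| ≤ K * B) :
    ∑ z ∈ Finset.univ.filter (fun z => blkOf D.toDomains z = y'), |T x z| ≤ K := by
  obtain ⟨sg, hsg⟩ : ∃ sg : ↥(boxDom (N0 ℓ Mh k P)) → ℝ, sg = fun z => if 0 ≤ T x z then 1 else -1 := ⟨_, rfl⟩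
  have hsg1 : ∀ z, |sg z| ≤ 1 := fun z => by rw [hsg]; dsimp only; split_ifs <;> simp
  have hsgT : ∀ z, T x z * sg z = |T x z| := fun z => by
    rw [hsg]; dsimp only; split_ifs with h0
    · rw [mul_one, abs_of_nonneg h0]
    · rw [mul_neg, mul_one, abs_of_neg (lt_of_not_ge h0)]
  obtain ⟨μ, hμ⟩ : ∃ μ : ↥(boxDom (N0 ℓ Mh k P)) → ℝ,
      μ = fun z => if blkOf D.toDomains z = y' then sg z else 0 := ⟨_, rfl⟩
  have hsupp : BlockSupp (g := geomT D) (blkOf D.toDomains) μ y' 1 :=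
    { nonneg := zero_le_one
      bound := fun z hz => by
        have hz' : (blkOf D.toDomains z : ↥(bset D.toDomains)) = y' := hz
        rw [hμ]; dsimp only; rw [if_pos hz']; exact hsg1 z
      off := fun z hz => by
        have hz' : ¬ (blkOf D.toDomains z : ↥(bset D.toDomains)) = y' := hz
        rw [hμ]; dsimp only; rw [if_neg hz'] }
  have h := hT μ 1 hsupp
  rw [mul_one] at h
  have e : (T *ᵥ μ) x = ∑ z ∈ Finset.univ.filter (fun z => blkOf D.toDomains z = y'), |T x z| := by
    rw [Matrix.mulVec, dotProduct, Finset.sum_filter]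
    refine Finset.sum_congr rfl fun z _ => ?_
    rw [hμ]; dsimp only
    by_cases hz : blkOf D.toDomains z = y'
    · rw [if_pos hz, if_pos hz, hsgT z]
    · rw [if_neg hz, if_neg hz, mul_zero]
  rw [e] at h
  exact le_trans (le_abs_self _) h

/-- **ROW SUMS FROM A MAJORANT**: `Σ_{z∈B(y′)}|T(x,z)| ≤ K(y(x), y′)`.
[cite: Balaban1984PropagatorsII, (2.51) p.232, (2.67) p.234, dictionary] -/
theorem row_abs_sum_le {T : Matrix ↥(boxDom (N0 ℓ Mh k P)) ↥(boxDom (N0 ℓ Mh k P)) ℝ}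
    {K : ↥(bset D.toDomains) → ↥(bset D.toDomains) → ℝ}
    (hT : HasMajorant (g := geomT D) (blkOf D.toDomains) (Matrix.toLin' T) K) (x : ↥(boxDom (N0 ℓ Mh k P)))
    (y' : ↥(bset D.toDomains)) :
    ∑ z ∈ Finset.univ.filter (fun z => blkOf D.toDomains z = y'), |T x z| ≤ K (blkOf D.toDomains x) y' :=
  row_abs_sum_le_of_bound D x y' fun μ B hμ => by
    have h := hT y' μ B hμ x
    rw [Matrix.toLin'_apply] at h
    exact h

/-- **COLUMN SUMS FROM A MAJORANT OF THE TRANSPOSE**: `Σ_{x∈B(y)}|T(x,z)| ≤ K′(y(z), y)`.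
[cite: Balaban1984PropagatorsII, (2.51) p.232, (2.67) p.234, dictionary] -/
theorem col_abs_sum_le {T : Matrix ↥(boxDom (N0 ℓ Mh k P)) ↥(boxDom (N0 ℓ Mh k P)) ℝ}
    {K' : ↥(bset D.toDomains) → ↥(bset D.toDomains) → ℝ}
    (hT : HasMajorant (g := geomT D) (blkOf D.toDomains) (Matrix.toLin' Tᵀ) K') (z : ↥(boxDom (N0 ℓ Mh k P)))
    (y : ↥(bset D.toDomains)) :
    ∑ x ∈ Finset.univ.filter (fun x => blkOf D.toDomains x = y), |T x z| ≤ K' (blkOf D.toDomains z) y := by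
  have h := row_abs_sum_le D hT z y
  simpa only [Matrix.transpose_apply] using h

/-- **THE `L²` BLOCK BOUND FROM ROW AND COLUMN SUMS** (Schur): for `λ = 0` off `B(y′)`,
`Σ_{x∈B(y)}((Tλ)(x))² ≤ K_r·K_c·Σ_zλ(z)²` when the rows `x ∈ B(y)` have `Σ_{z∈B(y′)}|T(x,z)| ≤ K_r` and the columns
`z ∈ B(y′)` have `Σ_{x∈B(y)}|T(x,z)| ≤ K_c`. [cite: Balaban1985BackgroundPropagators, (3.46) p.398; Balaban1984PropagatorsII, (2.67) p.234] -/
theorem l2_block_sq_le_of_sums {T : Matrix ↥(boxDom (N0 ℓ Mh k P)) ↥(boxDom (N0 ℓ Mh k P)) ℝ}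
    (y y' : ↥(bset D.toDomains)) {Kr Kc : ℝ} (hKr : 0 ≤ Kr) (hKc : 0 ≤ Kc)
    (hrow : ∀ x, blkOf D.toDomains x = y → ∑ z ∈ Finset.univ.filter (fun z => blkOf D.toDomains z = y'), |T x z| ≤ Kr)
    (hcol : ∀ z, blkOf D.toDomains z = y' → ∑ x ∈ Finset.univ.filter (fun x => blkOf D.toDomains x = y), |T x z| ≤ Kc)
    (lam : ↥(boxDom (N0 ℓ Mh k P)) → ℝ) (hlam : ∀ z, blkOf D.toDomains z ≠ y' → lam z = 0) :
    ∑ x ∈ Finset.univ.filter (fun x => blkOf D.toDomains x = y), ((T *ᵥ lam) x) ^ 2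
      ≤ Kr * Kc * ∑ z, lam z ^ 2 := by
  -- the doubly cut kernel
  obtain ⟨Kk, hKk⟩ : ∃ Kk : ↥(boxDom (N0 ℓ Mh k P)) → ↥(boxDom (N0 ℓ Mh k P)) → ℝ,
      Kk = fun x z => (if blkOf D.toDomains x = y then 1 else 0) * T x z * (if blkOf D.toDomains z = y' then 1 else 0) :=
    ⟨_, rfl⟩
  have hrow' : ∀ x, ∑ z, |Kk x z| ≤ Kr := by
    intro x
    by_cases hx : blkOf D.toDomains x = y
    · refine le_trans (le_of_eq ?_) (hrow x hx)
      rw [Finset.sum_filter]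
      refine Finset.sum_congr rfl fun z _ => ?_
      rw [hKk]; dsimp only; rw [if_pos hx]
      split_ifs <;> simp
    · refine le_trans (le_of_eq ?_) hKr
      refine Finset.sum_eq_zero fun z _ => ?_
      rw [hKk]; dsimp only; rw [if_neg hx]; simp
  have hcol' : ∀ z, ∑ x, |Kk x z| ≤ Kc := by
    intro z
    by_cases hz : blkOf D.toDomains z = y'
    · refine le_trans (le_of_eq ?_) (hcol z hz)
      rw [Finset.sum_filter]
      refine Finset.sum_congr rfl fun x _ => ?_
      rw [hKk]; dsimp only; rw [if_pos hz]
      split_ifs <;> simp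
    · refine le_trans (le_of_eq ?_) hKc
      refine Finset.sum_eq_zero fun x _ => ?_
      rw [hKk]; dsimp only; rw [if_neg hz]; simp
  have hschur := schur_sq Kk lam hKr hrow' hcol'
  -- the left side is the block sum of `(Tλ)²`
  have hleft : ∑ x, (∑ z, Kk x z * lam z) ^ 2
      = ∑ x ∈ Finset.univ.filter (fun x => blkOf D.toDomains x = y), ((T *ᵥ lam) x) ^ 2 := by
    rw [Finset.sum_filter]
    refine Finset.sum_congr rfl fun x _ => ?_
    by_cases hx : blkOf D.toDomains x = y
    · rw [if_pos hx]
      congr 1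
      rw [Matrix.mulVec, dotProduct]
      refine Finset.sum_congr rfl fun z _ => ?_
      rw [hKk]; dsimp only; rw [if_pos hx, one_mul]
      by_cases hz : blkOf D.toDomains z = y'
      · rw [if_pos hz, mul_one]
      · rw [if_neg hz, hlam z hz]; simp
    · rw [if_neg hx]
      have : ∀ z, Kk x z * lam z = 0 := fun z => by rw [hKk]; dsimp only; rw [if_neg hx]; simp
      simp [this]
  rw [hleft] at hschur
  exact hschur

/-- **THE `L²` BLOCK BOUND** from the two majorants: for `λ = 0` off `B(y′)`,
`Σ_{x∈B(y)}((Tλ)(x))² ≤ K(y,y′)·K′(y′,y)·Σ_zλ(z)²`. [cite: Balaban1985BackgroundPropagators, (3.46) p.398; Balaban1984PropagatorsII, (2.67) p.234] -/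
theorem l2_block_sq_le {T : Matrix ↥(boxDom (N0 ℓ Mh k P)) ↥(boxDom (N0 ℓ Mh k P)) ℝ}
    {K K' : ↥(bset D.toDomains) → ↥(bset D.toDomains) → ℝ}
    (hT : HasMajorant (g := geomT D) (blkOf D.toDomains) (Matrix.toLin' T) K)
    (hT' : HasMajorant (g := geomT D) (blkOf D.toDomains) (Matrix.toLin' Tᵀ) K')
    (y y' : ↥(bset D.toDomains)) (hK0 : 0 ≤ K y y') (hK'0 : 0 ≤ K' y' y)
    (lam : ↥(boxDom (N0 ℓ Mh k P)) → ℝ) (hlam : ∀ z, blkOf D.toDomains z ≠ y' → lam z = 0) :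
    ∑ x ∈ Finset.univ.filter (fun x => blkOf D.toDomains x = y), ((T *ᵥ lam) x) ^ 2
      ≤ K y y' * K' y' y * ∑ z, lam z ^ 2 := by
  refine l2_block_sq_le_of_sums D y y' hK0 hK'0 (fun x hx => ?_) (fun z hz => ?_) lam hlam
  · have h := row_abs_sum_le D hT x y'
    rw [hx] at h
    exact h
  · have h := col_abs_sum_le D hT' z y
    rw [hz] at h
    exact h

/-- **FROM BLOCKS TO UNIONS OF BLOCKS** (print's `supp h ⊂ Δ̃(y)`, a bounded union of blocks): for a finite set `S`
of blocks, `Σ_{x : B(x)∈S}((Tλ)(x))² ≤ (Σ_{b∈S} K(b,y′)K′(y′,b))·Σλ²` for `λ = 0` off `B(y′)`.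
[cite: Balaban1985BackgroundPropagators, (3.46) p.398 («supp h ⊂ Δ̃(y)»); Balaban1984PropagatorsII, (2.67) p.234] -/
theorem l2_union_sq_le {T : Matrix ↥(boxDom (N0 ℓ Mh k P)) ↥(boxDom (N0 ℓ Mh k P)) ℝ}
    {K K' : ↥(bset D.toDomains) → ↥(bset D.toDomains) → ℝ}
    (hT : HasMajorant (g := geomT D) (blkOf D.toDomains) (Matrix.toLin' T) K)
    (hT' : HasMajorant (g := geomT D) (blkOf D.toDomains) (Matrix.toLin' Tᵀ) K')
    (S : Finset ↥(bset D.toDomains)) (y' : ↥(bset D.toDomains)) (hK0 : ∀ b ∈ S, 0 ≤ K b y')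
    (hK'0 : ∀ b ∈ S, 0 ≤ K' y' b)
    (lam : ↥(boxDom (N0 ℓ Mh k P)) → ℝ) (hlam : ∀ z, blkOf D.toDomains z ≠ y' → lam z = 0) :
    ∑ x ∈ Finset.univ.filter (fun x => blkOf D.toDomains x ∈ S), ((T *ᵥ lam) x) ^ 2
      ≤ (∑ b ∈ S, K b y' * K' y' b) * ∑ z, lam z ^ 2 := by
  classical
  have hsplit : ∑ x ∈ Finset.univ.filter (fun x => blkOf D.toDomains x ∈ S), ((T *ᵥ lam) x) ^ 2
      = ∑ b ∈ S, ∑ x ∈ Finset.univ.filter (fun x => blkOf D.toDomains x = b), ((T *ᵥ lam) x) ^ 2 := by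
    rw [← Finset.sum_biUnion]
    · refine Finset.sum_congr ?_ fun _ _ => rfl
      ext x
      simp only [Finset.mem_filter, Finset.mem_univ, true_and, Finset.mem_biUnion, exists_eq_right']
    · intro b _ b' _ hbb'
      simp only [Function.onFun]
      rw [Finset.disjoint_filter]
      intro x _ hxb hxb'
      exact hbb' (hxb.symm.trans hxb')
  rw [hsplit, Finset.sum_mul]
  exact Finset.sum_le_sum fun b hb => l2_block_sq_le D hT hT' b y' (hK0 b hb) (hK'0 b hb) lam hlam

end Blocks

/-! ## §3 The `L²` members (3.46) at `U = 1` on the genuine `k`-level torus -/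

section Members

variable {ℓ Mh k R : ℕ} {P : Fin (d + 1) → ℕ}

/-- **(3.46) AT `U = 1`, THE `G′` MEMBER**: `k`-uniform `δ, C, M₀, N₀` such that for all admissible data, every torus
family `D`, blocks `y, y′` of `𝔅[D]` and `λ = 0` off `B(y′)`:
`Σ_{x∈B(y)}((G′λ)(x))² ≤ C·L^{2j(y)}·L^{2j(y′)}·e^{−δd(y,y′)}·Σλ²` — i.e. `‖1_{B(y)}G′λ‖₂ ≤ √C·L^{j+j′}·e^{−½δd}‖λ‖₂`
(rows and, by `G′ᵀ = G′`, columns from the torus (2.67)₁ `prop22_first_multiLevelTorus`).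
[cite: Balaban1985BackgroundPropagators, (3.46) p.398 (first member, «(Lʲη)²», powers conventional); Balaban1984PropagatorsII, Prop. 2.2 (2.67) p.234 (first entry), (2.13)–(2.14) p.225] -/
theorem ineq346_Gp_flat_multiLevelTorus (d ℓ : ℕ) (hℓ : 1 ≤ ℓ) (aminus aplus a2minus a2plus : ℝ) (ha : 0 < aminus)
    (ha2 : 0 < a2minus) :
    ∃ δ C M₀ : ℝ, ∃ N₀ : ℕ, 0 < δ ∧ 0 < C ∧ 0 < M₀ ∧ 0 < N₀ ∧
      ∀ (k Mh R : ℕ), 3 ≤ Mh → M₀ ≤ ((ℓ : ℝ) + 1) * Mh → 2 * (ℓ + 1) ≤ R → N₀ + 1 ≤ R * ((ℓ + 1) * Mh) →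
      ∀ (P : Fin (d + 1) → ℕ) (hP : ∀ μ, 1 ≤ P μ) (hP4 : ∀ μ, 4 ≤ P μ) (D : TDomains d ℓ Mh k P R) (a c : ℕ → ℝ),
        (∀ i, 1 ≤ i → aminus ≤ a i ∧ a i ≤ aplus) → (∀ i, 1 ≤ i → a2minus ≤ c i ∧ c i ≤ a2plus) →
        (∀ i, 1 ≤ i → a (i + 1) = aNext ℓ (a i) (c i)) →
      ∀ (y y' : ↥(bset D.toDomains)) (lam : ↥(boxDom (N0 ℓ Mh k P)) → ℝ),
        (∀ z, blkOf D.toDomains z ≠ y' → lam z = 0) →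
        ∑ x ∈ Finset.univ.filter (fun x => blkOf D.toDomains x = y), ((gmlT (N0 ℓ Mh k P) ℓ k D.lev a *ᵥ lam) x) ^ 2
          ≤ C * ((ℓ : ℝ) + 1) ^ (2 * y.1.1) * ((ℓ : ℝ) + 1) ^ (2 * y'.1.1)
            * Real.exp (-(δ * (geomT D).dist y y')) * ∑ z, lam z ^ 2 := by
  obtain ⟨δ₀, C₀, M₀, N₀, hδ₀, hC₀, hM₀, hN₀, hfirst⟩ := prop22_first_multiLevelTorus d ℓ hℓ aminus aplus a2minus a2plus ha ha2
  refine ⟨δ₀, C₀ * C₀, M₀, N₀, hδ₀, by positivity, hM₀, hN₀, ?_⟩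
  intro k Mh R hMh hM hR hRM P hP hP4 D a c haw hcw hac y y' lam hlam
  have hMh1 : 1 ≤ Mh := le_trans (by norm_num) hMh
  have hG := hfirst k Mh R hMh hM hR hRM P hP hP4 D a c haw hcw hac
  have hGt : HasMajorant (g := geomT D) (blkOf D.toDomains) (Matrix.toLin' (gmlT (N0 ℓ Mh k P) ℓ k D.lev a)ᵀ)
      (fun y y' => C₀ * ((ℓ : ℝ) + 1) ^ (2 * y.1.1) * Real.exp (-(δ₀ / 2 * (geomT D).dist y y'))) := by
    rw [gmlT_transpose]; exact hG
  have h := l2_block_sq_le D hG hGt y y' (by positivity) (by positivity) lam hlam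
  have hsymm : (geomT D).dist y' y = (geomT D).dist y y' := symmT D y' y
  rw [hsymm] at h
  calc _ ≤ _ := h
    _ = C₀ * C₀ * ((ℓ : ℝ) + 1) ^ (2 * y.1.1) * ((ℓ : ℝ) + 1) ^ (2 * y'.1.1)
          * (Real.exp (-(δ₀ / 2 * (geomT D).dist y y')) * Real.exp (-(δ₀ / 2 * (geomT D).dist y y')))
          * ∑ z, lam z ^ 2 := by ring
    _ = _ := by rw [← Real.exp_add]; ring_nf

/-- **(3.46) AT `U = 1`, THE `∇G′` MEMBER**: `Σ_{x∈B(y)}((∇_μG′λ)(x))² ≤ C·L^{j(y)}·L^{j(y′)}·e^{−δd(y,y′)}·Σλ²` for `λ = 0`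
off `B(y′)` (rows from (2.67)₂ `prop22_second_multiLevelTorus`, columns from `(∇_μG′)ᵀ = G′∇_μ*` and (2.67)₃
`prop22_third_multiLevelTorus`). [cite: Balaban1985BackgroundPropagators, (3.46) p.398 («Lʲη» member, powers conventional); Balaban1984PropagatorsII, Prop. 2.2 (2.67) p.234 (second and third entries)] -/
theorem ineq346_dGp_flat_multiLevelTorus (d ℓ : ℕ) (hℓ : 1 ≤ ℓ) (aminus aplus a2minus a2plus : ℝ) (ha : 0 < aminus)
    (ha2 : 0 < a2minus) :
    ∃ δ C M₀ : ℝ, ∃ N₀ : ℕ, 0 < δ ∧ 0 < C ∧ 0 < M₀ ∧ 0 < N₀ ∧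
      ∀ (k Mh R : ℕ), 3 ≤ Mh → M₀ ≤ ((ℓ : ℝ) + 1) * Mh → 2 * (ℓ + 1) ≤ R → N₀ + 1 ≤ R * ((ℓ + 1) * Mh) →
      ∀ (P : Fin (d + 1) → ℕ) (hP : ∀ μ, 1 ≤ P μ) (hP4 : ∀ μ, 4 ≤ P μ) (D : TDomains d ℓ Mh k P R) (a c : ℕ → ℝ),
        (∀ i, 1 ≤ i → aminus ≤ a i ∧ a i ≤ aplus) → (∀ i, 1 ≤ i → a2minus ≤ c i ∧ c i ≤ a2plus) →
        (∀ i, 1 ≤ i → a (i + 1) = aNext ℓ (a i) (c i)) →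
      ∀ (μ : Fin (d + 1)) (y y' : ↥(bset D.toDomains)) (lam : ↥(boxDom (N0 ℓ Mh k P)) → ℝ),
        (∀ z, blkOf D.toDomains z ≠ y' → lam z = 0) →
        ∑ x ∈ Finset.univ.filter (fun x => blkOf D.toDomains x = y),
            (((dT (N0 ℓ Mh k P) μ * gmlT (N0 ℓ Mh k P) ℓ k D.lev a) *ᵥ lam) x) ^ 2
          ≤ C * ((ℓ : ℝ) + 1) ^ y.1.1 * ((ℓ : ℝ) + 1) ^ y'.1.1
            * Real.exp (-(δ * (geomT D).dist y y')) * ∑ z, lam z ^ 2 := by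
  obtain ⟨δ₂, C₂, M₂, N₂, hδ₂, hC₂, hM₂, hN₂, hsecond⟩ :=
    prop22_second_multiLevelTorus d ℓ hℓ aminus aplus a2minus a2plus ha ha2
  obtain ⟨δ₃, C₃, M₃, N₃, hδ₃, hC₃, hM₃, -, hthird⟩ := prop22_third_multiLevelTorus d ℓ hℓ aminus aplus a2minus a2plus ha ha2
  refine ⟨min (δ₂ / 2) (δ₃ / 2), C₂ * C₃, max M₂ M₃, max N₂ N₃, lt_min (by positivity) (by positivity), by positivity,
    lt_of_lt_of_le hM₂ (le_max_left _ _), lt_of_lt_of_le hN₂ (le_max_left _ _), ?_⟩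
  intro k Mh R hMh hM hR hRM P hP hP4 D a c haw hcw hac μ y y' lam hlam
  have hMh1 : 1 ≤ Mh := le_trans (by norm_num) hMh
  have hM2 : M₂ ≤ ((ℓ : ℝ) + 1) * Mh := le_trans (le_max_left _ _) hM
  have hM3 : M₃ ≤ ((ℓ : ℝ) + 1) * Mh := le_trans (le_max_right _ _) hM
  have hN2' : N₂ + 1 ≤ R * ((ℓ + 1) * Mh) := le_trans (Nat.add_le_add_right (le_max_left _ _) 1) hRM
  have hN3' : N₃ + 1 ≤ R * ((ℓ + 1) * Mh) := le_trans (Nat.add_le_add_right (le_max_right _ _) 1) hRM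
  have hS := hsecond k Mh R hMh hM2 hR hN2' P hP hP4 D a c haw hcw hac μ
  have hT := hthird k Mh R hMh hM3 hR hN3' P hP hP4 D a c haw hcw hac μ
  have hSt : HasMajorant (g := geomT D) (blkOf D.toDomains)
      (Matrix.toLin' (dT (N0 ℓ Mh k P) μ * gmlT (N0 ℓ Mh k P) ℓ k D.lev a)ᵀ)
      (fun y y' => C₃ * ((ℓ : ℝ) + 1) ^ y.1.1 * Real.exp (-(δ₃ / 2 * (geomT D).dist y y'))) := by
    rw [Matrix.transpose_mul, gmlT_transpose]; exact hT
  have h := l2_block_sq_le D hS hSt y y' (by positivity) (by positivity) lam hlam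
  have hsymm : (geomT D).dist y' y = (geomT D).dist y y' := symmT D y' y
  rw [hsymm] at h
  have hd0 : 0 ≤ (geomT D).dist y y' := (triangle_refl_nonneg_T D hMh1 hP).2.2 y y'
  have hsum0 : 0 ≤ ∑ z, lam z ^ 2 := Finset.sum_nonneg fun z _ => sq_nonneg _
  have hw : Real.exp (-(δ₂ / 2 * (geomT D).dist y y')) * Real.exp (-(δ₃ / 2 * (geomT D).dist y y'))
      ≤ Real.exp (-(min (δ₂ / 2) (δ₃ / 2) * (geomT D).dist y y')) := by
    rw [← Real.exp_add, Real.exp_le_exp]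
    have h1 := min_le_left (δ₂ / 2) (δ₃ / 2)
    have : 0 ≤ δ₃ / 2 * (geomT D).dist y y' := by positivity
    nlinarith
  calc _ ≤ _ := h
    _ = C₂ * C₃ * ((ℓ : ℝ) + 1) ^ y.1.1 * ((ℓ : ℝ) + 1) ^ y'.1.1
          * (Real.exp (-(δ₂ / 2 * (geomT D).dist y y')) * Real.exp (-(δ₃ / 2 * (geomT D).dist y y')))
          * ∑ z, lam z ^ 2 := by ring
    _ ≤ C₂ * C₃ * ((ℓ : ℝ) + 1) ^ y.1.1 * ((ℓ : ℝ) + 1) ^ y'.1.1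
          * Real.exp (-(min (δ₂ / 2) (δ₃ / 2) * (geomT D).dist y y')) * ∑ z, lam z ^ 2 :=
        mul_le_mul_of_nonneg_right (mul_le_mul_of_nonneg_left hw (by positivity)) hsum0

/-- **(3.46) AT `U = 1`, THE `G′∇*` MEMBER**: `Σ_{x∈B(y)}((G′∇_μ*λ)(x))² ≤ C·L^{j(y)}·L^{j(y′)}·e^{−δd(y,y′)}·Σλ²` for
`λ = 0` off `B(y′)` (rows from (2.67)₃, columns from `(G′∇_μ*)ᵀ = ∇_μG′` and (2.67)₂). [cite: Balaban1985BackgroundPropagators, (3.46) p.398 with the p.398 remark on ∇_U/∇*_U; Balaban1984PropagatorsII, Prop. 2.2 (2.67) p.234 (second and third entries)] -/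
theorem ineq346_Gpd_flat_multiLevelTorus (d ℓ : ℕ) (hℓ : 1 ≤ ℓ) (aminus aplus a2minus a2plus : ℝ) (ha : 0 < aminus)
    (ha2 : 0 < a2minus) :
    ∃ δ C M₀ : ℝ, ∃ N₀ : ℕ, 0 < δ ∧ 0 < C ∧ 0 < M₀ ∧ 0 < N₀ ∧
      ∀ (k Mh R : ℕ), 3 ≤ Mh → M₀ ≤ ((ℓ : ℝ) + 1) * Mh → 2 * (ℓ + 1) ≤ R → N₀ + 1 ≤ R * ((ℓ + 1) * Mh) →
      ∀ (P : Fin (d + 1) → ℕ) (hP : ∀ μ, 1 ≤ P μ) (hP4 : ∀ μ, 4 ≤ P μ) (D : TDomains d ℓ Mh k P R) (a c : ℕ → ℝ),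
        (∀ i, 1 ≤ i → aminus ≤ a i ∧ a i ≤ aplus) → (∀ i, 1 ≤ i → a2minus ≤ c i ∧ c i ≤ a2plus) →
        (∀ i, 1 ≤ i → a (i + 1) = aNext ℓ (a i) (c i)) →
      ∀ (μ : Fin (d + 1)) (y y' : ↥(bset D.toDomains)) (lam : ↥(boxDom (N0 ℓ Mh k P)) → ℝ),
        (∀ z, blkOf D.toDomains z ≠ y' → lam z = 0) →
        ∑ x ∈ Finset.univ.filter (fun x => blkOf D.toDomains x = y),
            (((gmlT (N0 ℓ Mh k P) ℓ k D.lev a * (dT (N0 ℓ Mh k P) μ)ᵀ) *ᵥ lam) x) ^ 2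
          ≤ C * ((ℓ : ℝ) + 1) ^ y.1.1 * ((ℓ : ℝ) + 1) ^ y'.1.1
            * Real.exp (-(δ * (geomT D).dist y y')) * ∑ z, lam z ^ 2 := by
  obtain ⟨δ₂, C₂, M₂, N₂, hδ₂, hC₂, hM₂, hN₂, hsecond⟩ :=
    prop22_second_multiLevelTorus d ℓ hℓ aminus aplus a2minus a2plus ha ha2
  obtain ⟨δ₃, C₃, M₃, N₃, hδ₃, hC₃, hM₃, -, hthird⟩ := prop22_third_multiLevelTorus d ℓ hℓ aminus aplus a2minus a2plus ha ha2
  refine ⟨min (δ₂ / 2) (δ₃ / 2), C₃ * C₂, max M₂ M₃, max N₂ N₃, lt_min (by positivity) (by positivity), by positivity,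
    lt_of_lt_of_le hM₂ (le_max_left _ _), lt_of_lt_of_le hN₂ (le_max_left _ _), ?_⟩
  intro k Mh R hMh hM hR hRM P hP hP4 D a c haw hcw hac μ y y' lam hlam
  have hMh1 : 1 ≤ Mh := le_trans (by norm_num) hMh
  have hM2 : M₂ ≤ ((ℓ : ℝ) + 1) * Mh := le_trans (le_max_left _ _) hM
  have hM3 : M₃ ≤ ((ℓ : ℝ) + 1) * Mh := le_trans (le_max_right _ _) hM
  have hN2' : N₂ + 1 ≤ R * ((ℓ + 1) * Mh) := le_trans (Nat.add_le_add_right (le_max_left _ _) 1) hRM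
  have hN3' : N₃ + 1 ≤ R * ((ℓ + 1) * Mh) := le_trans (Nat.add_le_add_right (le_max_right _ _) 1) hRM
  have hS := hsecond k Mh R hMh hM2 hR hN2' P hP hP4 D a c haw hcw hac μ
  have hT := hthird k Mh R hMh hM3 hR hN3' P hP hP4 D a c haw hcw hac μ
  have hTt : HasMajorant (g := geomT D) (blkOf D.toDomains)
      (Matrix.toLin' (gmlT (N0 ℓ Mh k P) ℓ k D.lev a * (dT (N0 ℓ Mh k P) μ)ᵀ)ᵀ)
      (fun y y' => C₂ * ((ℓ : ℝ) + 1) ^ y.1.1 * Real.exp (-(δ₂ / 2 * (geomT D).dist y y'))) := by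
    rw [Matrix.transpose_mul, Matrix.transpose_transpose, gmlT_transpose]; exact hS
  have h := l2_block_sq_le D hT hTt y y' (by positivity) (by positivity) lam hlam
  have hsymm : (geomT D).dist y' y = (geomT D).dist y y' := symmT D y' y
  rw [hsymm] at h
  have hd0 : 0 ≤ (geomT D).dist y y' := (triangle_refl_nonneg_T D hMh1 hP).2.2 y y'
  have hsum0 : 0 ≤ ∑ z, lam z ^ 2 := Finset.sum_nonneg fun z _ => sq_nonneg _
  have hw : Real.exp (-(δ₃ / 2 * (geomT D).dist y y')) * Real.exp (-(δ₂ / 2 * (geomT D).dist y y'))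
      ≤ Real.exp (-(min (δ₂ / 2) (δ₃ / 2) * (geomT D).dist y y')) := by
    rw [← Real.exp_add, Real.exp_le_exp]
    have h1 := min_le_left (δ₂ / 2) (δ₃ / 2)
    have : 0 ≤ δ₃ / 2 * (geomT D).dist y y' := by positivity
    nlinarith
  calc _ ≤ _ := h
    _ = C₃ * C₂ * ((ℓ : ℝ) + 1) ^ y.1.1 * ((ℓ : ℝ) + 1) ^ y'.1.1
          * (Real.exp (-(δ₃ / 2 * (geomT D).dist y y')) * Real.exp (-(δ₂ / 2 * (geomT D).dist y y')))
          * ∑ z, lam z ^ 2 := by ring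
    _ ≤ C₃ * C₂ * ((ℓ : ℝ) + 1) ^ y.1.1 * ((ℓ : ℝ) + 1) ^ y'.1.1
          * Real.exp (-(min (δ₂ / 2) (δ₃ / 2) * (geomT D).dist y y')) * ∑ z, lam z ^ 2 :=
        mul_le_mul_of_nonneg_right (mul_le_mul_of_nonneg_left hw (by positivity)) hsum0

end Members

/-! ## §4 The `ΔG′` member -/

section Lap

variable {ℓ Mh k R : ℕ} {P : Fin (d + 1) → ℕ}

/-- **`Q′*aQ′` PRESERVES BLOCK SUPPORT**: for `μ` supported in `B(y)` with `|μ| ≤ B`, `Q′*aQ′μ` is supported in `B(y)`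
with `|Q′*aQ′μ| ≤ a₊·L^{−2j(y)}·B` (the averaging cube of a site is its block; `0 ≤ a_j ≤ a₊`).
[cite: Balaban1984PropagatorsII, (2.14) p.225, (2.1) p.224, dictionary] -/
theorem vOp_mulVec_blockSupp (D : TDomains d ℓ Mh k P R) {a : ℕ → ℝ} {aplus : ℝ} (ha0 : ∀ j, 1 ≤ j → 0 ≤ a j)
    (hap : ∀ j, 1 ≤ j → a j ≤ aplus) {μ : ↥(boxDom (N0 ℓ Mh k P)) → ℝ} {y : ↥(bset D.toDomains)} {B : ℝ}
    (hμ : BlockSupp (g := geomT D) (blkOf D.toDomains) μ y B) :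
    BlockSupp (g := geomT D) (blkOf D.toDomains) (vOp (N0 ℓ Mh k P) ℓ k D.lev a *ᵥ μ) y
      (aplus * (((ℓ : ℝ) + 1) ^ (2 * y.1.1))⁻¹ * B) := by
  have hB : 0 ≤ B := hμ.nonneg
  have hap0 : 0 ≤ aplus := (ha0 1 le_rfl).trans (hap 1 le_rfl)
  -- a bound valid at every site, from the box lemma on `D.toDomains`
  have hall : ∀ x : ↥(boxDom (N0 ℓ Mh k P)), |(vOp (N0 ℓ Mh k P) ℓ k D.lev a *ᵥ μ) x|
      ≤ a (D.lev x.1) * ((((ℓ : ℝ) + 1) ^ D.lev x.1) ^ 2)⁻¹ * B := by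
    intro x
    have hg : ∀ z, blkOf D.toDomains z = blkOf D.toDomains x → |μ z| ≤ B := by
      intro z hz
      by_cases hzy : blkOf D.toDomains z = y
      · exact hμ.bound z hzy
      · rw [hμ.off z hzy, abs_zero]; exact hB
    have h := vOp_mulVec_abs_le D.toDomains (fun j hj => ha0 j hj) μ x hg
    rw [TDomains.toDomains_lev] at h
    exact h
  refine { nonneg := by positivity, bound := fun x hx => ?_, off := fun x hx => ?_ }
  · have hx' : blkOf D.toDomains x = y := hx
    have hlev : D.lev x.1 = y.1.1 := by
      have : (blkOf D.toDomains x).1.1 = y.1.1 := by rw [hx']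
      exact this
    have hlev1 : 1 ≤ D.lev x.1 := D.one_le_lev x.1
    refine (hall x).trans ?_
    rw [hlev, ← pow_mul, mul_comm y.1.1 2]
    rw [hlev] at hlev1
    exact mul_le_mul_of_nonneg_right (mul_le_mul_of_nonneg_right (hap _ hlev1) (inv_nonneg.2 (by positivity))) hB
  · -- off the block: every averaging partner of `x` lies in the block of `x`, where `μ` vanishes
    have hx' : ¬ blkOf D.toDomains x = y := hx
    rw [Matrix.mulVec, dotProduct]
    refine Finset.sum_eq_zero fun z _ => ?_
    have e := vOp_apply D.toDomains a x z
    rw [TDomains.toDomains_lev] at e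
    rw [e]
    unfold avgK
    by_cases hz : blk ((ℓ + 1) ^ D.lev x.1) z.1 = blk ((ℓ + 1) ^ D.lev x.1) x.1
    · have hzx : blkOf D.toDomains z = blkOf D.toDomains x :=
        blkOf_eq_of_blk_i_eq (D := D.toDomains) (i := D.lev x.1) (by rw [TDomains.toDomains_lev]) hz
      have hzy : blkOf D.toDomains z ≠ y := by rw [hzx]; exact hx'
      rw [hμ.off z hzy, mul_zero]
    · rw [if_neg hz, zero_mul]

/-- the weight transfer (2.60) in one family for ANY pair of blocks: `(L^{2j(t)}/L^{2j(s)})·e^{−¼δ·d(s,t)} ≤ L²` once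
`L² ≤ e^{¼δ(R·L·M_h − 1)}`. [cite: Balaban1984PropagatorsII, (2.60) p.234, p.235] -/
theorem transfer_pair (D₀ : TDomains d ℓ Mh k P R) (hMh : 1 ≤ Mh) (hP : ∀ μ, 1 ≤ P μ)
    (hRM : 1 ≤ R * ((ℓ + 1) * Mh)) {δ : ℝ} (hδ : 0 ≤ δ)
    (hthr : ((ℓ : ℝ) + 1) ^ 2 ≤ Real.exp (1 / 4 * δ * ((R : ℝ) * (((ℓ : ℝ) + 1) * Mh) - 1)))
    (s t : ↥(bset D₀.toDomains)) :
    ((ℓ : ℝ) + 1) ^ (2 * t.1.1) / ((ℓ : ℝ) + 1) ^ (2 * s.1.1) * Real.exp (-(1 / 4 * δ * (geomT D₀).dist s t))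
      ≤ ((ℓ : ℝ) + 1) ^ 2 := by
  have hL1 : (1 : ℝ) ≤ (ℓ : ℝ) + 1 := by linarith [(Nat.cast_nonneg ℓ : (0 : ℝ) ≤ ℓ)]
  have hsep : LevelSep (geomTB D₀) := levelSepTB D₀ hMh hP hRM
  have hRM0 : 0 ≤ (R : ℝ) * (((ℓ : ℝ) + 1) * Mh) - 1 := by
    have : (1 : ℝ) ≤ (R : ℝ) * (((ℓ : ℝ) + 1) * Mh) := by exact_mod_cast hRM
    linarith
  have hβ0 : 0 ≤ 1 / 4 * δ * ((R : ℝ) * (((ℓ : ℝ) + 1) * Mh) - 1) := mul_nonneg (by positivity) hRM0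
  have hmx : 1 / 4 * δ * ((R : ℝ) * (((ℓ : ℝ) + 1) * Mh) - 1) * mx (geomTB D₀) s t
      ≤ 1 / 4 * δ * (geomT D₀).dist s t := by
    have h := hsep s t
    rw [geomTB_RM D₀ hMh, geomTB_dist] at h
    calc 1 / 4 * δ * ((R : ℝ) * (((ℓ : ℝ) + 1) * Mh) - 1) * mx (geomTB D₀) s t
        = 1 / 4 * δ * (((R : ℝ) * (((ℓ : ℝ) + 1) * Mh) - 1) * mx (geomTB D₀) s t) := by ring
      _ ≤ 1 / 4 * δ * (geomT D₀).dist s t := mul_le_mul_of_nonneg_left h (by positivity)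
  have h1 := ratio_mul_exp_le (g := geomTB D₀) (by rw [geomTB_L]; exact hL1)
    (β := 1 / 4 * δ * ((R : ℝ) * (((ℓ : ℝ) + 1) * Mh) - 1)) hβ0 (by rw [geomTB_L]; exact hthr) s t
  have hratio : ratio (geomTB D₀) s t = ((ℓ : ℝ) + 1) ^ (2 * t.1.1) / ((ℓ : ℝ) + 1) ^ (2 * s.1.1) := by
    unfold ratio; rw [geomTB_L]; rfl
  rw [geomTB_L, hratio] at h1
  calc ((ℓ : ℝ) + 1) ^ (2 * t.1.1) / ((ℓ : ℝ) + 1) ^ (2 * s.1.1) * Real.exp (-(1 / 4 * δ * (geomT D₀).dist s t))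
      ≤ ((ℓ : ℝ) + 1) ^ (2 * t.1.1) / ((ℓ : ℝ) + 1) ^ (2 * s.1.1)
        * Real.exp (-(1 / 4 * δ * ((R : ℝ) * (((ℓ : ℝ) + 1) * Mh) - 1) * mx (geomTB D₀) s t)) :=
        mul_le_mul_of_nonneg_left (Real.exp_le_exp.2 (by linarith)) (by positivity)
    _ ≤ ((ℓ : ℝ) + 1) ^ 2 := h1

/-- **THE BLOCK MAJORANT OF `(ΔG′)ᵀ = G′Δ`** (periodic Laplacian, `U = 1`): from `G′Δ = 1 − G′Q′*aQ′` and the (2.67)₁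
majorant `C₀L^{2j}e^{−δd}` of `G′`, for every torus family and the (2.60)-threshold,
`|((ΔG′)ᵀμ)(x)| ≤ (1 + C₀a₊L²)·e^{−¾δ·d(y(x),y′)}·B` for `supp μ ⊂ B(y′)`, `|μ| ≤ B`.
[cite: Balaban1984PropagatorsII, (2.13)–(2.14) p.225, (2.67) p.234 (first entry), (2.60) p.234; Balaban1985BackgroundPropagators, (3.46) p.398] -/
theorem hasMajorant_transpose_lapGp (D : TDomains d ℓ Mh k P R) (hMh : 1 ≤ Mh) (hP : ∀ μ, 1 ≤ P μ)
    (hRM : 1 ≤ R * ((ℓ + 1) * Mh)) {a : ℕ → ℝ} {aplus : ℝ} (ha0 : ∀ j, 1 ≤ j → 0 ≤ a j)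
    (hap : ∀ j, 1 ≤ j → a j ≤ aplus) (ha1 : ∀ j, 1 ≤ j → 0 < a j) {C₀ δ : ℝ} (hC₀ : 0 ≤ C₀) (hδ : 0 ≤ δ)
    (hG : HasMajorant (g := geomT D) (blkOf D.toDomains) (Matrix.toLin' (gmlT (N0 ℓ Mh k P) ℓ k D.lev a))
      (fun y y' => C₀ * ((ℓ : ℝ) + 1) ^ (2 * y.1.1) * Real.exp (-(δ * (geomT D).dist y y'))))
    (hthr : ((ℓ : ℝ) + 1) ^ 2 ≤ Real.exp (1 / 4 * δ * ((R : ℝ) * (((ℓ : ℝ) + 1) * Mh) - 1))) :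
    HasMajorant (g := geomT D) (blkOf D.toDomains)
      (Matrix.toLin' (perLapT (N0 ℓ Mh k P) * gmlT (N0 ℓ Mh k P) ℓ k D.lev a)ᵀ)
      (fun y y' => (1 + C₀ * aplus * ((ℓ : ℝ) + 1) ^ 2) * Real.exp (-(3 / 4 * δ * (geomT D).dist y y'))) := by
  have hap0 : 0 ≤ aplus := (ha0 1 le_rfl).trans (hap 1 le_rfl)
  have hL0 : (0 : ℝ) < (ℓ : ℝ) + 1 := by positivity
  obtain ⟨-, hrefl, hd0⟩ := triangle_refl_nonneg_T D hMh hP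
  -- the identity `(ΔG′)ᵀ = 1 − G′·Q′*aQ′`
  have hident : (perLapT (N0 ℓ Mh k P) * gmlT (N0 ℓ Mh k P) ℓ k D.lev a)ᵀ
      = 1 - gmlT (N0 ℓ Mh k P) ℓ k D.lev a * vOp (N0 ℓ Mh k P) ℓ k D.lev a := by
    rw [Matrix.transpose_mul, gmlT_transpose, (perLapT_isSymm (N := N0 ℓ Mh k P)).eq,
      perLapT_eq_mlOpT_sub (N0 ℓ Mh k P) ℓ k D.lev a, Matrix.mul_sub,
      gmlT_mul_mlOpT_pos (one_le_N0 hMh hP) D.one_le_lev D.lev_le ha1]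
  rw [hident]
  intro y' μ B hμ x
  have hB : 0 ≤ B := hμ.nonneg
  rw [Matrix.toLin'_apply, Matrix.sub_mulVec, Matrix.one_mulVec, Pi.sub_apply, ← Matrix.mulVec_mulVec]
  -- the identity term
  have h1 : |μ x| ≤ Real.exp (-(3 / 4 * δ * (geomT D).dist (blkOf D.toDomains x) y')) * B := by
    by_cases hx : blkOf D.toDomains x = y'
    · rw [hx, hrefl, mul_zero, neg_zero, Real.exp_zero, one_mul]; exact hμ.bound x hx
    · rw [hμ.off x hx, abs_zero]; positivity
  -- the averaging term through the (2.67)₁ majorant and the transfer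
  have hv := vOp_mulVec_blockSupp D ha0 hap hμ
  have h2 := hG y' _ _ hv x
  rw [Matrix.toLin'_apply] at h2
  dsimp only at h2
  have htr := transfer_pair D hMh hP hRM hδ hthr y' (blkOf D.toDomains x)
  have hsplit : Real.exp (-(δ * (geomT D).dist (blkOf D.toDomains x) y'))
      = Real.exp (-(1 / 4 * δ * (geomT D).dist y' (blkOf D.toDomains x)))
        * Real.exp (-(3 / 4 * δ * (geomT D).dist (blkOf D.toDomains x) y')) := by
    rw [← Real.exp_add, symmT D y' (blkOf D.toDomains x)]; congr 1; ring
  have hpow : (0 : ℝ) < ((ℓ : ℝ) + 1) ^ (2 * y'.1.1) := by positivity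
  have h2' : |(gmlT (N0 ℓ Mh k P) ℓ k D.lev a *ᵥ (vOp (N0 ℓ Mh k P) ℓ k D.lev a *ᵥ μ)) x|
      ≤ C₀ * aplus * ((ℓ : ℝ) + 1) ^ 2 * Real.exp (-(3 / 4 * δ * (geomT D).dist (blkOf D.toDomains x) y')) * B := by
    refine h2.trans ?_
    rw [hsplit]
    calc C₀ * ((ℓ : ℝ) + 1) ^ (2 * (blkOf D.toDomains x).1.1)
          * (Real.exp (-(1 / 4 * δ * (geomT D).dist y' (blkOf D.toDomains x)))
            * Real.exp (-(3 / 4 * δ * (geomT D).dist (blkOf D.toDomains x) y')))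
          * (aplus * (((ℓ : ℝ) + 1) ^ (2 * y'.1.1))⁻¹ * B)
        = C₀ * aplus * (((ℓ : ℝ) + 1) ^ (2 * (blkOf D.toDomains x).1.1) / ((ℓ : ℝ) + 1) ^ (2 * y'.1.1)
            * Real.exp (-(1 / 4 * δ * (geomT D).dist y' (blkOf D.toDomains x))))
          * Real.exp (-(3 / 4 * δ * (geomT D).dist (blkOf D.toDomains x) y')) * B := by
          rw [div_eq_mul_inv]; ring
      _ ≤ C₀ * aplus * ((ℓ : ℝ) + 1) ^ 2 * Real.exp (-(3 / 4 * δ * (geomT D).dist (blkOf D.toDomains x) y')) * B := by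
          have := mul_le_mul_of_nonneg_left htr (by positivity : 0 ≤ C₀ * aplus)
          refine mul_le_mul_of_nonneg_right (mul_le_mul_of_nonneg_right ?_ (Real.exp_pos _).le) hB
          calc _ ≤ _ := this
            _ = _ := by ring
  calc |μ x - (gmlT (N0 ℓ Mh k P) ℓ k D.lev a *ᵥ (vOp (N0 ℓ Mh k P) ℓ k D.lev a *ᵥ μ)) x|
      ≤ |μ x| + |(gmlT (N0 ℓ Mh k P) ℓ k D.lev a *ᵥ (vOp (N0 ℓ Mh k P) ℓ k D.lev a *ᵥ μ)) x| := abs_sub _ _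
    _ ≤ Real.exp (-(3 / 4 * δ * (geomT D).dist (blkOf D.toDomains x) y')) * B
        + C₀ * aplus * ((ℓ : ℝ) + 1) ^ 2 * Real.exp (-(3 / 4 * δ * (geomT D).dist (blkOf D.toDomains x) y')) * B :=
        add_le_add h1 h2'
    _ = _ := by ring

/-- **(3.46) AT `U = 1`, THE `ΔG′` MEMBER**: `k`-uniform `δ, C, M₀, N₀` such that for all admissible data, every torus
family, blocks `y, y′` and `λ = 0` off `B(y′)`: `Σ_{x∈B(y)}((ΔG′λ)(x))² ≤ C·e^{−δd(y,y′)}·Σλ²` (rows: the torus (2.67)₆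
`prop22_sixth_multiLevelTorus`; columns: `hasMajorant_transpose_lapGp`; Schur).
[cite: Balaban1985BackgroundPropagators, (3.46) p.398 («‖hΔ_UG′(U)λ‖ ≤ B₀·1·e^{−δ₀d(y,y′)}‖λ‖»); Balaban1984PropagatorsII, Prop. 2.2 (2.67) p.234 (first and sixth entries)] -/
theorem ineq346_lapGp_flat_multiLevelTorus (d ℓ : ℕ) (hℓ : 1 ≤ ℓ) (aminus aplus a2minus a2plus : ℝ) (ha : 0 < aminus)
    (ha2 : 0 < a2minus) :
    ∃ δ C M₀ : ℝ, ∃ N₀ : ℕ, 0 < δ ∧ 0 < C ∧ 0 < M₀ ∧ 0 < N₀ ∧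
      ∀ (k Mh R : ℕ), 3 ≤ Mh → M₀ ≤ ((ℓ : ℝ) + 1) * Mh → 2 * (ℓ + 1) ≤ R → N₀ + 1 ≤ R * ((ℓ + 1) * Mh) →
      ∀ (P : Fin (d + 1) → ℕ) (hP : ∀ μ, 1 ≤ P μ) (hP4 : ∀ μ, 4 ≤ P μ) (D : TDomains d ℓ Mh k P R) (a c : ℕ → ℝ),
        (∀ i, 1 ≤ i → aminus ≤ a i ∧ a i ≤ aplus) → (∀ i, 1 ≤ i → a2minus ≤ c i ∧ c i ≤ a2plus) →
        (∀ i, 1 ≤ i → a (i + 1) = aNext ℓ (a i) (c i)) →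
      ∀ (y y' : ↥(bset D.toDomains)) (lam : ↥(boxDom (N0 ℓ Mh k P)) → ℝ),
        (∀ z, blkOf D.toDomains z ≠ y' → lam z = 0) →
        ∑ x ∈ Finset.univ.filter (fun x => blkOf D.toDomains x = y),
            (((perLapT (N0 ℓ Mh k P) * gmlT (N0 ℓ Mh k P) ℓ k D.lev a) *ᵥ lam) x) ^ 2
          ≤ C * Real.exp (-(δ * (geomT D).dist y y')) * ∑ z, lam z ^ 2 := by
  obtain ⟨δ₀, C₀, M₀, N₀, hδ₀, hC₀, hM₀, hN₀, hfirst⟩ := prop22_first_multiLevelTorus d ℓ hℓ aminus aplus a2minus a2plus ha ha2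
  obtain ⟨δ₆, C₆, M₆, N₆, hδ₆, hC₆, hM₆, -, hsixth⟩ := prop22_sixth_multiLevelTorus d ℓ hℓ aminus aplus a2minus a2plus ha ha2
  have hL0 : (0 : ℝ) < (ℓ : ℝ) + 1 := by positivity
  have hδ : (0 : ℝ) < δ₀ / 2 := by positivity
  obtain ⟨N₁, c₁, hN₁, -, hcon⟩ := consts_260_261 d ℓ hδ
  have hap0 : 0 ≤ max aplus aminus := le_trans ha.le (le_max_right _ _)
  refine ⟨min (δ₆ / 2) (3 / 4 * (δ₀ / 2)), C₆ * (1 + C₀ * max aplus aminus * ((ℓ : ℝ) + 1) ^ 2), max M₀ M₆,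
    max (max N₀ N₆) N₁, lt_min (by positivity) (by positivity), by positivity, lt_of_lt_of_le hM₀ (le_max_left _ _),
    lt_of_lt_of_le hN₁ (le_max_right _ _), ?_⟩
  intro k Mh R hMh hM hR hRM P hP hP4 D a c haw hcw hac y y' lam hlam
  have hMh1 : 1 ≤ Mh := le_trans (by norm_num) hMh
  have hM0' : M₀ ≤ ((ℓ : ℝ) + 1) * Mh := le_trans (le_max_left _ _) hM
  have hM6' : M₆ ≤ ((ℓ : ℝ) + 1) * Mh := le_trans (le_max_right _ _) hM
  have hRN0 : N₀ + 1 ≤ R * ((ℓ + 1) * Mh) :=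
    le_trans (Nat.add_le_add_right ((le_max_left _ _).trans (le_max_left _ _)) 1) hRM
  have hRN6 : N₆ + 1 ≤ R * ((ℓ + 1) * Mh) :=
    le_trans (Nat.add_le_add_right ((le_max_right _ _).trans (le_max_left _ _)) 1) hRM
  have hRN1 : N₁ + 1 ≤ R * ((ℓ + 1) * Mh) := le_trans (Nat.add_le_add_right (le_max_right _ _) 1) hRM
  have hRMone : 1 ≤ R * ((ℓ + 1) * Mh) := le_trans (by omega) hRN1
  obtain ⟨hthr, -⟩ := hcon k Mh R P hMh1 hP hRN1
  -- weights repaired at level 0 (the operator only sees levels ≥ 1)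
  obtain ⟨a', ha'0, ha'p, ha'1, ha'eq⟩ := weights_repair ha haw
  have hG := hfirst k Mh R hMh hM0' hR hRN0 P hP hP4 D a c haw hcw hac
  have hS := hsixth k Mh R hMh hM6' hR hRN6 P hP hP4 D a c haw hcw hac
  rw [gmlT_congr D ha'eq] at hG hS ⊢
  -- rows and columns
  have hcol := hasMajorant_transpose_lapGp D hMh1 hP hRMone (fun j _ => ha'0 j) (fun j _ => ha'p j) ha'1 hC₀.le hδ.le hG hthr
  have h := l2_block_sq_le D hS hcol y y' (by positivity) (by positivity) lam hlam
  have hsymm : (geomT D).dist y' y = (geomT D).dist y y' := symmT D y' y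
  rw [hsymm] at h
  have hd0 : 0 ≤ (geomT D).dist y y' := (triangle_refl_nonneg_T D hMh1 hP).2.2 y y'
  have hsum0 : 0 ≤ ∑ z, lam z ^ 2 := Finset.sum_nonneg fun z _ => sq_nonneg _
  have hw : Real.exp (-(δ₆ / 2 * (geomT D).dist y y')) * Real.exp (-(3 / 4 * (δ₀ / 2) * (geomT D).dist y y'))
      ≤ Real.exp (-(min (δ₆ / 2) (3 / 4 * (δ₀ / 2)) * (geomT D).dist y y')) := by
    rw [← Real.exp_add, Real.exp_le_exp]
    have h1 := min_le_left (δ₆ / 2) (3 / 4 * (δ₀ / 2))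
    have : 0 ≤ 3 / 4 * (δ₀ / 2) * (geomT D).dist y y' := by positivity
    nlinarith
  calc _ ≤ _ := h
    _ = C₆ * (1 + C₀ * max aplus aminus * ((ℓ : ℝ) + 1) ^ 2)
          * (Real.exp (-(δ₆ / 2 * (geomT D).dist y y')) * Real.exp (-(3 / 4 * (δ₀ / 2) * (geomT D).dist y y')))
          * ∑ z, lam z ^ 2 := by ring
    _ ≤ C₆ * (1 + C₀ * max aplus aminus * ((ℓ : ℝ) + 1) ^ 2)
          * Real.exp (-(min (δ₆ / 2) (3 / 4 * (δ₀ / 2)) * (geomT D).dist y y')) * ∑ z, lam z ^ 2 :=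
        mul_le_mul_of_nonneg_right (mul_le_mul_of_nonneg_left hw (by positivity)) hsum0

end Lap

end

end Literature.MathematicalPhysics.QuantumFieldTheory.Balaban1983to89.B9Ineq346GpFlatMultiLevelTorus
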